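import Summits.FinalStateConjecture.FinalStateConjecture.Theorems.ClusterCompletenessAdiabaticMultiKerrILEDWeightedTCurrent
import Summits.FinalStateConjecture.FinalStateConjecture.Theorems.ClusterCompletenessAdiabaticMultiKerrILEDWeightedTEnergyGraph

/-!
# Route ClusterCompleteness — crux `AdiabaticMultiKerrILED`, line `Sketch`:
# the weighted `T`-energy inequality WITH SOURCE for the rest-frame tails-cut zone

Helper file for the crux `stmt-FinalStateConjecture-14310`
(`Summit.FinalStateConjecture.FinalStateConjecture.Theses.ClusterCompleteness.AdiabaticMultiKerrILED`),
line `Sketch`, stubs `weightedTEnergy_graph_le_source` (main) and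
`sum_fderiv_weightedTCurrent_ge_source` (lead c7, wave 3).

Setting (one zone, zero spin, rest frame): the coefficient field is the tails-cut Kerr–Schild field
`G₀ = KerrSchild.inverseMetric φ (Kerr.nullVector 0)` with profile `φ = χ(2 − r/(8M)) · 2H`
(`χ = Real.smoothTransition`), the current is the Killing energy current
`(J^T)^μ = KerrSchild.multiplierCurrent G₀ KerrSchild.timeField Φ`, and the weight is
`W = χ(u₂/ε − 1) · χ(u₁)` with the receding horizon function `u₂ = Kerr.horizonFn M 0` and the cone
function `u₁ = Kerr.coneFn A c`. These are the INHOMOGENEOUS versions of the landed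
`sum_fderiv_weightedTCurrent_nonneg` (…`WeightedTCurrent`) and `weightedTEnergy_graph_le`
(…`WeightedTEnergyGraph`): no wave equation is assumed, and the source `□_{G₀} Φ` enters as an
error term.

* `sum_fderiv_weightedTCurrent_ge_source` — **`∑_μ ∂_μ (W (J^T)^μ) ≥ W (□_{G₀}Φ)(∂₀Φ)` at points
  `r > 2M`, `x⁰ < A`, `Φ ∈ C²` at `x`**: Leibniz (`weightedT_sum_fderiv_mul_mul`) gives
  `W ∑_μ ∂_μ(J^T)^μ + χ(u₂/ε−1) ∑ ∂[χ∘u₁] J^T + χ(u₁) ∑ ∂[χ(u₂/ε−1)] J^T`; the first term is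
  `W (□Φ)(∂₀Φ)` (`KerrSchild.sum_fderiv_multiplierCurrent`, `∑_α T^α ∂_αΦ = ∂₀Φ`, `K^T = 0` by
  `multiplierBulk_timeField_tailsCut_eq_zero`), the other two are `≥ 0`
  (`sum_fderiv_coneFactor_mul_multiplierCurrent_timeField_nonneg`,
  `tailsCut_horizonFactor_flux_nonneg`, `χ ≥ 0`);
* `continuousAt_tailsCut_waveOperator` — `□_{G₀} Φ` is continuous at points `r > 0` for `Φ ∈ C²`
  there;
* `continuous_weightedTSource` — the error density `e = W |(□_{G₀}Φ)(∂₀Φ)|` of a `C²` function is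
  continuous on `ℝ⁴` (a product of continuous functions on `{r > M}`, identically zero near
  `{r ≤ M}` where the horizon factor vanishes);
* `weightedGraphFlux_integral_le_of_source` — the abstract step with an error term: for a weight
  `W` vanishing off a closed `K` whose slab points are spatially bounded with a property `P`, a
  current `J` with `W J ∈ C¹`, and a continuous `e ≥ 0` vanishing off `K` with
  `∑ ∂(W J) ≥ −e` at the slab points with `P`, the weighted flux through `{x⁰ = s + F}` is at most
  the one through `{x⁰ = F}` plus `∫_0^s ∫ e` (`E4.graphFlux_add_integral_le_of_divergence_le`
  with `ℓ = 0`, and the passage from ball integrals to integrals over `ℝ³`);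
* `weightedTEnergy_graph_le_source` — **the registered main stub**: the support set
  `K = {ε ≤ u₂} ∩ {0 ≤ u₁}`, `r > 2M` on `K`, the slab geometry
  `spatialNorm_le_of_coneFn_nonneg_of_slab`, and the items above with `e = W |(□Φ)(∂₀Φ)|`.

Dafermos–Rodnianski–Shlapentokh-Rothman arXiv:1402.7034, §2.3.1–§2.3.2 (the `T`-energy identity
with source, (ingeneralform2)); Hawking–Ellis 1973, §4.3 Lemma 4.3.1. [folklore]
-/

noncomputable section

-- the doubled `FinalStateConjecture.FinalStateConjecture` path component trips dupNamespace
set_option linter.dupNamespace false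

open Set Filter Metric MeasureTheory
open scoped BigOperators Topology
open Literature.Geometry.Lorentzian

namespace Summit.FinalStateConjecture.FinalStateConjecture.Theorems

/-! ### Pointwise: the divergence of the weighted current with source -/

/-- **The weighted Killing current has divergence at least the weighted source term**: for the
tails-cut zero-spin zone (`M > 0`), `ε > 0`, a point `x` with `x⁰ < A` and `r(x) > 2M`, and `Φ` of
class `C²` at `x`, `W(x) (□_{G₀}Φ)(x) (∂₀Φ)(x) ≤ ∑_μ ∂_μ (W (J^T)^μ)(x)`, `W = χ(u₂/ε − 1) χ(u₁)`.
By Leibniz (`weightedT_sum_fderiv_mul_mul`) the divergence is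
`W ∑_μ ∂_μ(J^T)^μ + χ(u₂/ε − 1) ∑_μ ∂_μ[χ∘u₁] (J^T)^μ + χ(u₁) ∑_μ ∂_μ[χ(u₂/ε − 1)] (J^T)^μ`; the
first term is `W (□Φ) ∂₀Φ` since `∑_μ ∂_μ (J^T)^μ = (□Φ) T(Φ) + K^T`
(`KerrSchild.sum_fderiv_multiplierCurrent`) with `T(Φ) = ∂₀Φ` (`KerrSchild.sum_timeField_mul`) and
`K^T = 0` (`multiplierBulk_timeField_tailsCut_eq_zero`, `T` is Killing), and the two weight terms
are `≥ 0` by `sum_fderiv_coneFactor_mul_multiplierCurrent_timeField_nonneg` (`0 ≤ φ(x) < 1`, `ℓ♯`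
null with `η(ℓ♯, ∂₀) = 1`) and `tailsCut_horizonFactor_flux_nonneg`, times `χ ≥ 0`.
DRSR arXiv:1402.7034, §2.3.1–§2.3.2; Hawking–Ellis 1973, §4.3, Lemma 4.3.1. [folklore] -/
theorem sum_fderiv_weightedTCurrent_ge_source : ∀ (M ε A : ℝ) (c : E3) (Φ : E4 → ℝ) (x : E4), 0 < M → 0 < ε → x 0 < A → 2 * M < Kerr.radius 0 x → ContDiffAt ℝ 2 Φ x → (Real.smoothTransition (Kerr.horizonFn M 0 x / ε - 1) * Real.smoothTransition (Kerr.coneFn A c x)) * (KerrSchild.waveOperator (KerrSchild.inverseMetric (fun z ↦ Real.smoothTransition (2 - Kerr.radius 0 z / (8 * M)) * (2 * Kerr.scalarH M 0 z)) (Kerr.nullVector 0)) Φ x * fderiv ℝ Φ x (E4.basisVector 0)) ≤ ∑ μ, fderiv ℝ (fun y ↦ (Real.smoothTransition (Kerr.horizonFn M 0 y / ε - 1) * Real.smoothTransition (Kerr.coneFn A c y)) * KerrSchild.multiplierCurrent (KerrSchild.inverseMetric (fun z ↦ Real.smoothTransition (2 - Kerr.radius 0 z / (8 * M)) * (2 *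 Kerr.scalarH M 0 z)) (Kerr.nullVector 0)) KerrSchild.timeField Φ y μ) x (E4.basisVector μ) := by
  intro M ε A c Φ x hM hε hxA hx hΦ
  have hxpos : 0 < Kerr.radius 0 x := lt_trans (by positivity) hx
  have hrp : 0 < Kerr.rPlus M 0 := by
    rw [Kerr.rPlus_zero_right hM.le]
    positivity
  -- differentiability of the three factors at `x`
  have h₁ : DifferentiableAt ℝ (fun y ↦ Real.smoothTransition (Kerr.horizonFn M 0 y / ε - 1)) x :=
    (Kerr.contDiff_horizonFactor (a := 0) (n := 1) hrp hε).differentiable (by simp) x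
  have h₂ : DifferentiableAt ℝ (fun y ↦ Real.smoothTransition (Kerr.coneFn A c y)) x :=
    ((Real.smoothTransition.contDiff (n := 1)).comp (Kerr.contDiff_coneFn A c)).differentiable
      (by simp) x
  have hG : ∀ μ ν, ContDiffAt ℝ 1 (fun y ↦ KerrSchild.inverseMetric
      (fun z ↦ Real.smoothTransition (2 - Kerr.radius 0 z / (8 * M)) * (2 * Kerr.scalarH M 0 z))
      (Kerr.nullVector 0) y μ ν) x :=
    fun μ ν ↦ contDiffAt_tailsCut_inverseMetric M 0 hxpos μ ν (n := 1)
  have hX : ∀ α, ContDiffAt ℝ 1 (fun y ↦ KerrSchild.timeField y α) x :=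
    fun α ↦ (KerrSchild.contDiff_timeField α).contDiffAt
  have hJ : ∀ μ, DifferentiableAt ℝ (fun y ↦ KerrSchild.multiplierCurrent (KerrSchild.inverseMetric
      (fun z ↦ Real.smoothTransition (2 - Kerr.radius 0 z / (8 * M)) * (2 * Kerr.scalarH M 0 z))
      (Kerr.nullVector 0)) KerrSchild.timeField Φ y μ) x :=
    fun μ ↦ (KerrSchild.contDiffAt_multiplierCurrent hG hX hΦ μ).differentiableAt one_ne_zero
  -- `∑_μ ∂_μ (J^T)^μ = (□Φ) T(Φ) + K^T = (□Φ) ∂₀Φ`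
  have hdiv : ∑ μ, fderiv ℝ (fun y ↦ KerrSchild.multiplierCurrent (KerrSchild.inverseMetric
      (fun z ↦ Real.smoothTransition (2 - Kerr.radius 0 z / (8 * M)) * (2 * Kerr.scalarH M 0 z))
      (Kerr.nullVector 0)) KerrSchild.timeField Φ y μ) x (E4.basisVector μ) =
      KerrSchild.waveOperator (KerrSchild.inverseMetric
        (fun z ↦ Real.smoothTransition (2 - Kerr.radius 0 z / (8 * M)) * (2 * Kerr.scalarH M 0 z))
        (Kerr.nullVector 0)) Φ x * fderiv ℝ Φ x (E4.basisVector 0) := by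
    rw [KerrSchild.sum_fderiv_multiplierCurrent (fun μ ν ↦ (hG μ ν).differentiableAt one_ne_zero)
      (KerrSchild.inverseMetric_symm _ _ x) (fun α ↦ (hX α).differentiableAt one_ne_zero) hΦ,
      KerrSchild.sum_timeField_mul, multiplierBulk_timeField_tailsCut_eq_zero M 0 Φ x hxpos,
      add_zero]
  -- the Kerr–Schild data at `x`: `0 ≤ φ < 1`, `ℓ♯` null and normalised
  have hφ0 := weightedT_profile_nonneg hM.le 0 x
  have hφ1 := weightedT_profile_lt_one hM.le hx
  have hnull : Minkowski.bilin (Kerr.nullVector 0 x) (Kerr.nullVector 0 x) = 0 := by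
    rw [Kerr.bilin_nullVector, Kerr.nullCovector_nullVector hxpos]
  have hnorm : Minkowski.bilin (Kerr.nullVector 0 x) (E4.basisVector 0) = 1 := by
    rw [Kerr.bilin_nullVector, Kerr.nullCovector_basisVector_zero]
  -- the two signed weight terms
  have hcone := sum_fderiv_coneFactor_mul_multiplierCurrent_timeField_nonneg
    (fun z ↦ Real.smoothTransition (2 - Kerr.radius 0 z / (8 * M)) * (2 * Kerr.scalarH M 0 z))
    (Kerr.nullVector 0) Φ A c x hxA hφ0 hφ1 hnull hnorm
  have hhor := tailsCut_horizonFactor_flux_nonneg M ε Φ x hM hε hx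
  have hW₁ : 0 ≤ Real.smoothTransition (Kerr.horizonFn M 0 x / ε - 1) :=
    Real.smoothTransition.nonneg _
  have hW₂ : 0 ≤ Real.smoothTransition (Kerr.coneFn A c x) := Real.smoothTransition.nonneg _
  rw [weightedT_sum_fderiv_mul_mul h₁ h₂ hJ, hdiv]
  have hsum := add_nonneg (mul_nonneg hW₁ hcone) (mul_nonneg hW₂ hhor)
  linarith

/-! ### Continuity of the source density `W |(□Φ)(∂₀Φ)|` -/

/-- **The tails-cut wave operator of a `C²` function is continuous at points `r > 0`**: each
`A^μ = ∑_ν G^{μν} ∂_νΦ` is `C¹` at `x` (the components of the tails-cut field are smooth on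
`{r > 0}`, `contDiffAt_tailsCut_inverseMetric`), so `∂_μ A^μ` is continuous at `x`. [folklore] -/
theorem continuousAt_tailsCut_waveOperator (M a : ℝ) {Φ : E4 → ℝ} {x : E4}
    (hΦ : ContDiffAt ℝ 2 Φ x) (hx : 0 < Kerr.radius a x) :
    ContinuousAt (KerrSchild.waveOperator (KerrSchild.inverseMetric
      (fun z ↦ Real.smoothTransition (2 - Kerr.radius a z / (8 * M)) * (2 * Kerr.scalarH M a z))
      (Kerr.nullVector a)) Φ) x := by
  have hp : ∀ ν, ContDiffAt ℝ 1 (fun y ↦ fderiv ℝ Φ y (E4.basisVector ν)) x := fun ν ↦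
    (hΦ.fderiv_right (m := 1) le_rfl).clm_apply contDiffAt_const
  have hA : ∀ μ, ContDiffAt ℝ 1 (fun y ↦ ∑ ν, KerrSchild.inverseMetric
      (fun z ↦ Real.smoothTransition (2 - Kerr.radius a z / (8 * M)) * (2 * Kerr.scalarH M a z))
      (Kerr.nullVector a) y μ ν * fderiv ℝ Φ y (E4.basisVector ν)) x :=
    fun μ ↦ ContDiffAt.sum fun ν _ ↦ (contDiffAt_tailsCut_inverseMetric M a hx μ ν (n := 1)).mul (hp ν)
  unfold KerrSchild.waveOperator
  refine tendsto_finsetSum _ fun μ _ ↦ ?_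
  exact ((hA μ).continuousAt_fderiv one_ne_zero).clm_apply continuousAt_const

/-- **The weighted source density is continuous on `ℝ⁴`** (tails-cut zero-spin zone, `M > 0`,
`ε > 0`, `Φ ∈ C²(ℝ⁴)`): the map `x ↦ W(x) |(□_{G₀}Φ)(x) (∂₀Φ)(x)|`, `W = χ(u₂/ε − 1) χ(u₁)`. At
points with `r > M` it is a product of functions continuous at `x` (`W` is continuous on `ℝ⁴`,
`Kerr.contDiff_horizonFactor`; `□_{G₀}Φ` by `continuousAt_tailsCut_waveOperator`; `∂₀Φ` since
`Φ ∈ C²`); near a point with `r ≤ M` one has `r < 2M`, hence `u₂ ≤ 0`, the horizon factor vanishes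
and the density is identically zero. [folklore] -/
theorem continuous_weightedTSource (M ε A : ℝ) (c : E3) {Φ : E4 → ℝ} (hM : 0 < M) (hε : 0 < ε)
    (hΦ : ContDiff ℝ 2 Φ) :
    Continuous fun x ↦ (Real.smoothTransition (Kerr.horizonFn M 0 x / ε - 1) *
        Real.smoothTransition (Kerr.coneFn A c x)) *
      |KerrSchild.waveOperator (KerrSchild.inverseMetric
          (fun z ↦ Real.smoothTransition (2 - Kerr.radius 0 z / (8 * M)) * (2 * Kerr.scalarH M 0 z))
          (Kerr.nullVector 0)) Φ x * fderiv ℝ Φ x (E4.basisVector 0)| := by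
  have hrp : 0 < Kerr.rPlus M 0 := by
    rw [Kerr.rPlus_zero_right hM.le]
    positivity
  have hWc : Continuous fun y ↦ Real.smoothTransition (Kerr.horizonFn M 0 y / ε - 1) *
      Real.smoothTransition (Kerr.coneFn A c y) :=
    (Kerr.contDiff_horizonFactor (a := 0) (n := 0) hrp hε).continuous.mul
      (Real.smoothTransition.continuous.comp (Kerr.continuous_coneFn A c))
  have hd0 : Continuous fun y ↦ fderiv ℝ Φ y (E4.basisVector 0) :=
    (hΦ.continuous_fderiv two_ne_zero).clm_apply continuous_const
  rw [continuous_iff_continuousAt]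
  intro x
  rcases lt_or_ge M (Kerr.radius 0 x) with hx | hx
  · -- `r > M > 0`: a product of functions continuous at `x`
    have hxpos : 0 < Kerr.radius 0 x := hM.trans hx
    exact hWc.continuousAt.mul
      (((continuousAt_tailsCut_waveOperator M 0 hΦ.contDiffAt hxpos).mul hd0.continuousAt).abs)
  · -- `r ≤ M < 2M` near `x`: the horizon factor vanishes identically there
    have hev : ∀ᶠ y in 𝓝 x, Kerr.radius 0 y < 2 * M :=
      (Kerr.continuous_radius 0).continuousAt.eventually_lt continuousAt_const (by linarith)
    refine Filter.EventuallyEq.continuousAt (y := (0 : ℝ)) ?_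
    filter_upwards [hev] with y hy
    have h1 : Kerr.horizonFn M 0 y ≤ 0 := by
      unfold Kerr.horizonFn
      rw [Kerr.rPlus_zero_right hM.le]
      exact mul_nonpos_iff.mpr (Or.inr ⟨by linarith, (Real.exp_pos _).le⟩)
    have h2 : Kerr.horizonFn M 0 y / ε - 1 ≤ 0 := by
      have : Kerr.horizonFn M 0 y / ε ≤ 0 := div_nonpos_iff.mpr (Or.inr ⟨h1, hε.le⟩)
      linarith
    rw [Real.smoothTransition.zero_of_nonpos h2, zero_mul, zero_mul]

/-! ### The abstract weighted graph energy inequality with an error term -/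

/-- **Weighted graph energy inequality with source, abstract form.** Let `K ⊆ ℝ⁴` be closed, `W` a
weight vanishing off `K`, `J` a current with `W J^μ ∈ C¹(ℝ⁴)`, `F` a `C²` height and `s ≥ 0`.
Assume the points of `K` in the slab `{F(x⃗) ≤ x⁰ ≤ s + F(x⃗)}` have `‖x⃗‖ ≤ ρ` and a property
`P`, and that `∑_μ ∂_μ (W J^μ) ≥ −e` at the slab points with `P`, for a continuous `e ≥ 0`
vanishing off `K`. Then `∫ W (−∑_μ J^μ n_μ)` over the leaf `{x⁰ = s + F}` is at most the same
integral over `{x⁰ = F}` plus `∫_{u ∈ (0, s]} ∫ e(u + F(y), y) dy du` (`n = dt − dF`): the energy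
inequality `E4.graphFlux_add_integral_le_of_divergence_le` for the current `−W J` with `ℓ = 0`,
all integrands vanishing for `‖y‖ > ρ`. [cite: DafermosRodnianskiShlapentokhrothman2014, §2.3.2] -/
theorem weightedGraphFlux_integral_le_of_source {K : Set E4} (hKc : IsClosed K) {W : E4 → ℝ}
    {J : Fin 4 → E4 → ℝ} (hJ1 : ∀ μ, ContDiff ℝ 1 fun y ↦ W y * J μ y)
    (hWK : ∀ x, x ∉ K → W x = 0) {F : E3 → ℝ} (hF : ContDiff ℝ 2 F) {s ρ : ℝ} {P : E4 → Prop}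
    (hρ : ∀ x ∈ K, F (E4.spatial x) ≤ x 0 → x 0 ≤ s + F (E4.spatial x) →
      E4.spatialNorm x ≤ ρ ∧ P x)
    {e : E4 → ℝ} (hec : Continuous e) (he0 : ∀ x, 0 ≤ e x) (heK : ∀ x, x ∉ K → e x = 0)
    (hdiv : ∀ x, F (E4.spatial x) ≤ x 0 → x 0 ≤ s + F (E4.spatial x) → P x →
      -e x ≤ ∑ μ, fderiv ℝ (fun y ↦ W y * J μ y) x (E4.basisVector μ))
    (hs0 : 0 ≤ s) :
    ∫ y : E3, W (E4.ofTimeSpace (s + F y) y) *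
        (-∑ μ, J μ (E4.ofTimeSpace (s + F y) y) * Kerr.graphConormal F y μ) ≤
      (∫ y : E3, W (E4.ofTimeSpace (0 + F y) y) *
        (-∑ μ, J μ (E4.ofTimeSpace (0 + F y) y) * Kerr.graphConormal F y μ)) +
      ∫ u in Set.Ioc 0 s, ∫ y : E3, e (E4.ofTimeSpace (u + F y) y) := by
  -- the negated weighted current `J' = −W J`
  set J' : Fin 4 → E4 → ℝ := fun μ y ↦ -(W y * J μ y) with hJ'
  have hJ'1 : ∀ μ, ContDiff ℝ 1 (J' μ) := fun μ ↦ (hJ1 μ).neg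
  have hJ'K : ∀ μ x, x ∉ K → J' μ x = 0 := fun μ x hx ↦ by
    simp only [hJ', hWK x hx, zero_mul, neg_zero]
  have hρ' : ∀ x ∈ K, F (E4.spatial x) ≤ x 0 → x 0 ≤ s + F (E4.spatial x) →
      E4.spatialNorm x ≤ ρ := fun x hx h1 h2 ↦ (hρ x hx h1 h2).1
  have hdiv' : ∀ x ∈ K, F (E4.spatial x) ≤ x 0 → x 0 ≤ s + F (E4.spatial x) →
      ∑ μ, fderiv ℝ (J' μ) x (E4.basisVector μ) ≤
        -(fun _ : E4 ↦ (0 : ℝ)) x + e x := by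
    intro x hx h1 h2
    have h := hdiv x h1 h2 (hρ x hx h1 h2).2
    have he : ∀ μ, fderiv ℝ (J' μ) x = -fderiv ℝ (fun y ↦ W y * J μ y) x := fun μ ↦ by
      simp only [hJ', fderiv_fun_neg]
    simp only [he, neg_apply, Finset.sum_neg_distrib, neg_zero, zero_add]
    linarith
  have key := E4.graphFlux_add_integral_le_of_divergence_le hKc hJ'1 hJ'K hF hρ'
    (ℓ := fun _ ↦ 0) (e := e) continuous_const hec (fun _ _ ↦ rfl) he0 hdiv' hs0 le_rfl
  simp only [integral_zero, add_zero] at key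
  -- off the ball `‖y‖ ≤ ρ` the leaf points `(t + F y, y)`, `0 ≤ t ≤ s`, are not in `K`
  have hnotK : ∀ (t : ℝ) (y : E3), 0 ≤ t → t ≤ s → y ∉ closedBall (0 : E3) ρ →
      E4.ofTimeSpace (t + F y) y ∉ K := by
    intro t y ht0 hts hy hK
    refine hy ?_
    have h := (hρ _ hK
      (by simp only [E4.spatial_ofTimeSpace, E4.ofTimeSpace_apply_zero]; linarith)
      (by simp only [E4.spatial_ofTimeSpace, E4.ofTimeSpace_apply_zero]; linarith)).1
    rw [E4.spatialNorm_ofTimeSpace] at h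
    exact mem_closedBall_zero_iff.mpr h
  -- from ball integrals of `∑ J'^μ n_μ` to integrals of `W (−∑ J^μ n_μ)` over `ℝ³`
  have hleaf : ∀ t, 0 ≤ t → t ≤ s →
      (∫ y in closedBall (0 : E3) ρ, ∑ μ, J' μ (E4.ofTimeSpace (t + F y) y) *
        Kerr.graphConormal F y μ) = ∫ y : E3, W (E4.ofTimeSpace (t + F y) y) *
          (-∑ μ, J μ (E4.ofTimeSpace (t + F y) y) * Kerr.graphConormal F y μ) := by
    intro t ht0 hts
    rw [setIntegral_eq_integral_of_forall_compl_eq_zero]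
    · congr 1
      funext y
      simp only [hJ']
      rw [mul_neg, Finset.mul_sum, ← Finset.sum_neg_distrib]
      exact Finset.sum_congr rfl fun μ _ ↦ by ring
    · intro y hy
      have hW : W (E4.ofTimeSpace (t + F y) y) = 0 := hWK _ (hnotK t y ht0 hts hy)
      simp only [hJ', hW, zero_mul, neg_zero, Finset.sum_const_zero]
  -- from ball integrals of `e` to integrals over `ℝ³`
  have hbulk : (∫ u in Set.Ioc 0 s, ∫ y in closedBall (0 : E3) ρ,
      e (E4.ofTimeSpace (u + F y) y)) = ∫ u in Set.Ioc 0 s, ∫ y : E3,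
        e (E4.ofTimeSpace (u + F y) y) := by
    refine setIntegral_congr_fun measurableSet_Ioc fun u hu ↦ ?_
    exact setIntegral_eq_integral_of_forall_compl_eq_zero fun y hy ↦
      heK _ (hnotK u y hu.1.le hu.2 hy)
  rw [← hleaf s hs0 le_rfl, ← hleaf 0 le_rfl hs0, ← hbulk]
  exact key

/-! ### The registered main stub -/

/-- **The weighted `T`-energy inequality with source between tilted leaves** (crux
`stmt-FinalStateConjecture-14310`, line `Sketch`, stub `weightedTEnergy_graph_le_source`). For the
tails-cut zero-spin Kerr–Schild field `G₀`, the Killing current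
`J^T = KerrSchild.multiplierCurrent G₀ KerrSchild.timeField Φ` of a `C²` function `Φ` (no wave
equation assumed) and the weight `W = χ(u₂/ε − 1) χ(u₁)` (`u₂ = Kerr.horizonFn M 0`,
`u₁ = Kerr.coneFn A c`): if `W J^T ∈ C¹(ℝ⁴)` and `∑_μ ∂_μ(W (J^T)^μ) ≥ W (□_{G₀}Φ)(∂₀Φ)` at the
points of the slab `{F(x⃗) ≤ x⁰ ≤ s + F(x⃗)}` with `r > 2M`, `x⁰ < A` (`F ∈ C²` of slope `≤ 1/2`,
`0 ≤ s`, `s + F(c) < A`), then `∫ W (−∑ (J^T)^μ n_μ)` over the leaf `{x⁰ = s + F}` is at most the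
same over `{x⁰ = F}` plus the space-time integral `∫_{u ∈ (0,s]} ∫ W |(□_{G₀}Φ)(∂₀Φ)|` over the
leaves in between (`n = Kerr.graphConormal F`). Proof: `weightedGraphFlux_integral_le_of_source`
with the closed support set `K = {ε ≤ u₂} ∩ {0 ≤ u₁}` (off `K` a factor of `W` vanishes; on `K`,
`r > r₊ = 2M` by `Kerr.rPlus_lt_radius_of_horizonFn_pos`), the slab geometry
`spatialNorm_le_of_coneFn_nonneg_of_slab` with the mean value inequality, the continuous error
density `e = W |(□Φ)(∂₀Φ)|` (`continuous_weightedTSource`) and `−W|q| ≤ W q`.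
Dafermos–Rodnianski–Shlapentokh-Rothman arXiv:1402.7034, §2.3.2.
[cite: DafermosRodnianskiShlapentokhrothman2014, §2.3.2] -/
theorem weightedTEnergy_graph_le_source : ∀ (M ε A : ℝ) (c : E3) (F : E3 → ℝ) (Φ : E4 → ℝ) (s : ℝ), 0 < M → 0 < ε → ContDiff ℝ 2 F → (∀ y, ‖fderiv ℝ F y‖ ≤ 2⁻¹) → 0 ≤ s → s + F c < A → ContDiff ℝ 2 Φ → (∀ μ : Fin 4, ContDiff ℝ 1 (fun y ↦ (Real.smoothTransition (Kerr.horizonFn M 0 y / ε - 1) * Real.smoothTransition (Kerr.coneFn A c y)) * KerrSchild.multiplierCurrent (KerrSchild.inverseMetric (fun z ↦ Real.smoothTransition (2 - Kerr.radius 0 z / (8 * M)) * (2 * Kerr.scalarH M 0 z)) (Kerr.nullVector 0)) KerrSchild.timeField Φ y μ)) → (∀ x : E4, F (E4.spatial x) ≤ x 0 → x 0 ≤ s + F (E4.spatial x) → 2 * M < Kerr.radius 0 x → x 0 < A → (Real.smoothTransition (Kerr.horizonFn M 0 x / ε - 1) * Real.smoothTransition (Kerr.coneFn A c x)) * (KerrSchild.waveOperator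 (KerrSchild.inverseMetric (fun z ↦ Real.smoothTransition (2 - Kerr.radius 0 z / (8 * M)) * (2 * Kerr.scalarH M 0 z)) (Kerr.nullVector 0)) Φ x * fderiv ℝ Φ x (E4.basisVector 0)) ≤ ∑ μ, fderiv ℝ (fun y ↦ (Real.smoothTransition (Kerr.horizonFn M 0 y / ε - 1) * Real.smoothTransition (Kerr.coneFn A c y)) * KerrSchild.multiplierCurrent (KerrSchild.inverseMetric (fun z ↦ Real.smoothTransition (2 - Kerr.radius 0 z / (8 * M)) * (2 * Kerr.scalarH M 0 z)) (Kerr.nullVector 0)) KerrSchild.timeField Φ y μ) x (E4.basisVector μ)) → ∫ y : E3, (Real.smoothTransition (Kerr.horizonFn M 0 (E4.ofTimeSpace (s + F y) y) / ε - 1) * Real.smoothTransition (Kerr.coneFn A c (E4.ofTimeSpace (s + F y) y))) * (-∑ μ, KerrSchild.multiplierCurrent (KerrSchild.inverseMetric (fun z ↦ Real.smoothTransition (2 - Kerr.radius 0 z / (8 * M)) * (2 * Kerr.scalarH M 0 z)) (Kerr.nullVector 0)) KerrSchild.timeField Φ (E4.ofTimeSpace (s + F y) y) μ * Kerr.graphConormal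 F y μ) ≤ (∫ y : E3, (Real.smoothTransition (Kerr.horizonFn M 0 (E4.ofTimeSpace (0 + F y) y) / ε - 1) * Real.smoothTransition (Kerr.coneFn A c (E4.ofTimeSpace (0 + F y) y))) * (-∑ μ, KerrSchild.multiplierCurrent (KerrSchild.inverseMetric (fun z ↦ Real.smoothTransition (2 - Kerr.radius 0 z / (8 * M)) * (2 * Kerr.scalarH M 0 z)) (Kerr.nullVector 0)) KerrSchild.timeField Φ (E4.ofTimeSpace (0 + F y) y) μ * Kerr.graphConormal F y μ)) + ∫ u in Set.Ioc 0 s, ∫ y : E3, (Real.smoothTransition (Kerr.horizonFn M 0 (E4.ofTimeSpace (u + F y) y) / ε - 1) * Real.smoothTransition (Kerr.coneFn A c (E4.ofTimeSpace (u + F y) y))) * |KerrSchild.waveOperator (KerrSchild.inverseMetric (fun z ↦ Real.smoothTransition (2 - Kerr.radius 0 z / (8 * M)) * (2 * Kerr.scalarH M 0 z)) (Kerr.nullVector 0)) Φ (E4.ofTimeSpace (u + F y) y) * fderiv ℝ Φ (E4.ofTimeSpace (u + F y) y) (E4.basisVector 0)| := by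
  intro M ε A c F Φ s hM hε hF hdF hs0 hsA hΦ hJ1 hdiv
  -- the support set of the weight: closed
  set K : Set E4 := {x | ε ≤ Kerr.horizonFn M 0 x ∧ 0 ≤ Kerr.coneFn A c x} with hK
  have hKc : IsClosed K := by
    rw [hK, Set.setOf_and]
    exact (isClosed_le continuous_const (Kerr.continuous_horizonFn M 0)).inter
      (isClosed_le continuous_const (Kerr.continuous_coneFn A c))
  -- the weight vanishes off `K` and is non-negative
  have hWK : ∀ x, x ∉ K →
      Real.smoothTransition (Kerr.horizonFn M 0 x / ε - 1) *
        Real.smoothTransition (Kerr.coneFn A c x) = 0 := by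
    intro x hx
    by_contra hne
    refine hx ⟨(Kerr.lt_horizonFn_of_weight_ne_zero hε (left_ne_zero_of_mul hne)).le, ?_⟩
    by_contra hlt
    exact right_ne_zero_of_mul hne (Real.smoothTransition.zero_of_nonpos (not_le.mp hlt).le)
  have hW0 : ∀ x, 0 ≤ Real.smoothTransition (Kerr.horizonFn M 0 x / ε - 1) *
      Real.smoothTransition (Kerr.coneFn A c x) :=
    fun x ↦ mul_nonneg (Real.smoothTransition.nonneg _) (Real.smoothTransition.nonneg _)
  -- the mean value inequality for the height `F`
  have hlip : ∀ y : E3, |F y - F c| ≤ 2⁻¹ * ‖y - c‖ := fun y ↦ by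
    rw [← Real.norm_eq_abs]
    exact convex_univ.norm_image_sub_le_of_norm_fderiv_le
      (fun z _ ↦ hF.differentiable (by simp) z) (fun z _ ↦ hdF z) (mem_univ c) (mem_univ y)
  -- slab points of `K`: spatially bounded, strictly exterior, early
  have hρ : ∀ x ∈ K, F (E4.spatial x) ≤ x 0 → x 0 ≤ s + F (E4.spatial x) →
      E4.spatialNorm x ≤ ‖c‖ + 2 * (A - F c) ∧ (2 * M < Kerr.radius 0 x ∧ x 0 < A) := by
    intro x hx h1 h2
    have hr : 2 * M < Kerr.radius 0 x := by
      rw [← Kerr.rPlus_zero_right hM.le]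
      exact Kerr.rPlus_lt_radius_of_horizonFn_pos (lt_of_lt_of_le hε hx.1)
    have hg := spatialNorm_le_of_coneFn_nonneg_of_slab (hlip (E4.spatial x)) hsA hx.2 h1 h2
    exact ⟨hg.1, hr, hg.2⟩
  -- the source term dominates minus the error density: `−W |q| ≤ W q`
  have he : ∀ x : E4,
      -((Real.smoothTransition (Kerr.horizonFn M 0 x / ε - 1) *
          Real.smoothTransition (Kerr.coneFn A c x)) *
        |KerrSchild.waveOperator (KerrSchild.inverseMetric
            (fun z ↦ Real.smoothTransition (2 - Kerr.radius 0 z / (8 * M)) * (2 * Kerr.scalarH M 0 z))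
            (Kerr.nullVector 0)) Φ x * fderiv ℝ Φ x (E4.basisVector 0)|) ≤
      (Real.smoothTransition (Kerr.horizonFn M 0 x / ε - 1) *
          Real.smoothTransition (Kerr.coneFn A c x)) *
        (KerrSchild.waveOperator (KerrSchild.inverseMetric
            (fun z ↦ Real.smoothTransition (2 - Kerr.radius 0 z / (8 * M)) * (2 * Kerr.scalarH M 0 z))
            (Kerr.nullVector 0)) Φ x * fderiv ℝ Φ x (E4.basisVector 0)) := by
    intro x
    rw [← mul_neg]
    exact mul_le_mul_of_nonneg_left (neg_abs_le _) (hW0 x)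
  exact weightedGraphFlux_integral_le_of_source (P := fun x ↦ 2 * M < Kerr.radius 0 x ∧ x 0 < A)
    (W := fun y ↦ Real.smoothTransition (Kerr.horizonFn M 0 y / ε - 1) *
      Real.smoothTransition (Kerr.coneFn A c y))
    (J := fun μ y ↦ KerrSchild.multiplierCurrent (KerrSchild.inverseMetric
      (fun z ↦ Real.smoothTransition (2 - Kerr.radius 0 z / (8 * M)) * (2 * Kerr.scalarH M 0 z))
      (Kerr.nullVector 0)) KerrSchild.timeField Φ y μ)
    (e := fun x ↦ (Real.smoothTransition (Kerr.horizonFn M 0 x / ε - 1) *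
        Real.smoothTransition (Kerr.coneFn A c x)) *
      |KerrSchild.waveOperator (KerrSchild.inverseMetric
          (fun z ↦ Real.smoothTransition (2 - Kerr.radius 0 z / (8 * M)) * (2 * Kerr.scalarH M 0 z))
          (Kerr.nullVector 0)) Φ x * fderiv ℝ Φ x (E4.basisVector 0)|)
    hKc hJ1 hWK hF hρ (continuous_weightedTSource M ε A c hM hε hΦ)
    (fun x ↦ mul_nonneg (hW0 x) (abs_nonneg _))
    (fun x hx ↦ by simp only [hWK x hx, zero_mul])
    (fun x h1 h2 hP ↦ (he x).trans (hdiv x h1 h2 hP.1 hP.2)) hs0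

end Summit.FinalStateConjecture.FinalStateConjecture.Theorems
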